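/-
Origin: expansion seat `planner-pub-hodgecm-pv13-g3-0`, handover #1 2026-08-18T06:20:36Z (`HOME/pub-hodgecm-pv13-g3/lean/Pv13g3/LocalModulus.lean`, md5 d3a6898b, 367 lines);
landed by the gen-6 packager in gate run 24 as `HodgeCM/PerL34/LocalModulus.lean` (verbatim).
-/
/-
Copyright: HodgeCM publication cell (pub-hodgecm), DAG node N31 — seam S3, split places (prover pv13, gen 3).
Released under the package licence.

# The modulus of a non-archimedean local field: Haar scaling, `|ϖ|_K = 1/q`, boxes in `K^d`

Source under adjudication (NOT cited as a fact; this file PROVES typed pieces of the model facts it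
uses): PerL v5 = `inputs/2001/summits__hodge-w-picard-modular-quadrilinear-period-galois-
closure__free__y1__paper__paper.tex`, Lemma 4.2(b), proof, tex ll. 610–611 and 629–630:

  610–611: … in the Schrödinger model of `ω_{ψ,v}` restricted to `U(W_{i,v}) × U(V_v) ≅ F_v^× × GL_3(F_v)`
           … `U(W_{i,v}) = F_v^×` acts by `(ω(y)φ)(x) = ν(y)|y|^{3/2} φ(yx)` for a unitary character `ν`.
  629–630: (the unramified vector `φ_v^0 = 1_{𝒪_v^3}` … gives local coefficient
           `⟨ω_v(y)φ^0_v, φ^0_v⟩ = q_v^{-3|ord y|/2} ν(y)` …)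

## What this file does (pure Mathlib; no package import)

For a non-trivially normed, ultrametric, proper (= locally compact) field `K`, an additive Haar
measure `μ` on `K`, and `u, ϖ ∈ Kˣ`:
* `unitBall K` (`𝒪 = {‖x‖ ≤ 1}`) and `piBall ϖ` (`ϖ𝒪 = {‖x‖ ≤ ‖ϖ‖}`) as OPEN additive subgroups;
  `𝒪` is compact, open, of positive finite measure; `u • closedBall 0 r = closedBall 0 (‖u‖ r)`.
* THE MODULUS is Mathlib's `distribHaarChar K : Kˣ →* ℝ≥0` (`μ (u • s) = |u|_K · μ s` for every
  additive Haar measure — `modulus_mul_measure`); `|u|_K = 1` when `‖u‖ = 1`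
  (`distribHaarChar_eq_one_of_norm_eq_one`); `|u|_K ≤ 1` when `‖u‖ ≤ 1`.
* `resIndex ϖ = [𝒪 : ϖ𝒪]` (a natural number: `ϖ𝒪` is an open subgroup of the compact group `𝒪`),
  `resIndex_mul_measure : [𝒪 : ϖ𝒪] · μ(ϖ𝒪) = μ(𝒪)` (coset counting + translation invariance),
  `two_le_resIndex` (`‖ϖ‖ < 1`), and **`distribHaarChar_uniformizer : |ϖ|_K = [𝒪 : ϖ𝒪]⁻¹`** — the
  tex's normalisation `|ϖ_v| = q_v⁻¹` is a THEOREM about the Haar modulus, `q_v := [𝒪_v : ϖ_v 𝒪_v]`.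
* boxes in `K^d = Fin d → K` with the product measure: `measure_box`, `smul_box`, and
  **`distribHaarChar_pi : |u|_{K^d} = |u|_K ^ d`** (so `|y|^{3/2} = (|y|_{K³})^{1/2}`: the exponent in
  l. 610–611 is the one making `ω(y)` unitary on `L²(F_v³)` — the model itself is pv07-g2's
  `LocalFactors.DilationModel`, whose one displayed input `hq : distribHaarChar F ϖ = (q : ℝ≥0)⁻¹`
  (`DilationModulus.shellParam_three_eq_tOf`) is `distribHaarChar_uniformizer` here with
  `q := resIndex ϖ`).
Nothing is cited; no hypothesis names PerL, QW8 or a 2001-programme claim.  Axioms = the standard trio.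
Unit `pub-hodgecm-pv13-g3` (DAG-node prover #13, generation 3), 2026-08-18.
-/
import Mathlib.MeasureTheory.Measure.Haar.DistribChar
import Mathlib.MeasureTheory.Group.Measure
import Mathlib.MeasureTheory.Constructions.Pi
import Mathlib.Analysis.Normed.Group.Ultra
import Mathlib.Analysis.Normed.Module.Ball.Pointwise
import Mathlib.Topology.MetricSpace.Ultra.Basic
import Mathlib.Topology.MetricSpace.Ultra.Pi
import Mathlib.Topology.Algebra.OpenSubgroup

set_option autoImplicit false

noncomputable section

open MeasureTheory MeasureTheory.Measure Set Metric Filter Topology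
open scoped Pointwise NNReal ENNReal

namespace HodgeCM.PerL34.LocalModulus

/-! ## §0 Regularity of additive Haar measures on proper normed groups -/

/-- On a proper normed additive group every additive Haar measure is regular (Mathlib's
`regular_of_isAddLeftInvariant` with the compact unit ball). -/
theorem regular_of_isAddHaarMeasure {E : Type*} [NormedAddCommGroup E] [ProperSpace E]
    [MeasurableSpace E] [BorelSpace E] (μ : Measure E) [IsAddHaarMeasure μ] : μ.Regular :=
  Measure.regular_of_isAddLeftInvariant (isCompact_closedBall (0 : E) 1)
    ⟨0, ball_subset_interior_closedBall (mem_ball_self one_pos)⟩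
    (isCompact_closedBall (0 : E) 1).measure_lt_top.ne

variable (K : Type*) [NontriviallyNormedField K] [IsUltrametricDist K]

/-! ## §1 `𝒪` and `ϖ𝒪` as open additive subgroups -/

/-- `𝒪 := {x : ‖x‖ ≤ 1}`, the closed unit ball, an OPEN additive subgroup (ultrametric inequality). -/
def unitBall : OpenAddSubgroup K := IsUltrametricDist.closedBall_openAddSubgroup K one_pos

variable {K}

/-- (Ported verbatim from the HodgeCMPerL package; no docstring in the source.) -/
@[simp] theorem coe_unitBall : ((unitBall K : OpenAddSubgroup K) : Set K) = closedBall (0 : K) 1 := rfl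

/-- (Ported verbatim from the HodgeCMPerL package; no docstring in the source.) -/
theorem mem_unitBall {x : K} : x ∈ unitBall K ↔ ‖x‖ ≤ 1 := by
  change x ∈ closedBall (0 : K) 1 ↔ _
  rw [mem_closedBall_zero_iff]

/-- `ϖ𝒪 = {x : ‖x‖ ≤ ‖ϖ‖}` for `ϖ ∈ Kˣ`, an open additive subgroup. -/
def piBall (ϖ : Kˣ) : OpenAddSubgroup K :=
  IsUltrametricDist.closedBall_openAddSubgroup K (norm_pos_iff.mpr ϖ.ne_zero)

/-- (Ported verbatim from the HodgeCMPerL package; no docstring in the source.) -/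
@[simp] theorem coe_piBall (ϖ : Kˣ) : ((piBall ϖ : OpenAddSubgroup K) : Set K) = closedBall (0 : K) (‖(ϖ : K)‖) :=
  rfl

/-- (Ported verbatim from the HodgeCMPerL package; no docstring in the source.) -/
theorem mem_piBall {ϖ : Kˣ} {x : K} : x ∈ piBall ϖ ↔ ‖x‖ ≤ ‖(ϖ : K)‖ := by
  change x ∈ closedBall (0 : K) ‖(ϖ : K)‖ ↔ _
  rw [mem_closedBall_zero_iff]

/-- (Ported verbatim from the HodgeCMPerL package; no docstring in the source.) -/
theorem isOpen_closedBall_zero {r : ℝ} (hr : 0 < r) : IsOpen (closedBall (0 : K) r) :=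
  IsUltrametricDist.isOpen_closedBall _ hr.ne'

omit [IsUltrametricDist K] in
/-- (Ported verbatim from the HodgeCMPerL package; no docstring in the source.) -/
theorem units_smul_closedBall (u : Kˣ) (r : ℝ) :
    u • closedBall (0 : K) r = closedBall (0 : K) (‖(u : K)‖ * r) := by
  rw [Units.smul_def, smul_closedBall' u.ne_zero, smul_zero]

omit [IsUltrametricDist K] in
/-- (Ported verbatim from the HodgeCMPerL package; no docstring in the source.) -/
theorem units_smul_unitBall (u : Kˣ) : u • closedBall (0 : K) 1 = closedBall (0 : K) ‖(u : K)‖ := by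
  rw [units_smul_closedBall, mul_one]

omit [IsUltrametricDist K] in
/-- (Ported verbatim from the HodgeCMPerL package; no docstring in the source.) -/
theorem preimage_units_smul_closedBall (u : Kˣ) (r : ℝ) :
    (fun x : K => u • x) ⁻¹' closedBall (0 : K) r = closedBall (0 : K) (‖((u⁻¹ : Kˣ) : K)‖ * r) := by
  rw [preimage_smul, units_smul_closedBall]

omit [IsUltrametricDist K] in
/-- (Ported verbatim from the HodgeCMPerL package; no docstring in the source.) -/
theorem closedBall_zero_inter (r s : ℝ) :
    closedBall (0 : K) r ∩ closedBall (0 : K) s = closedBall (0 : K) (min r s) := by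
  ext x
  simp only [mem_inter_iff, mem_closedBall_zero_iff, le_min_iff]

/-- (Ported verbatim from the HodgeCMPerL package; no docstring in the source.) -/
theorem piBall_le_unitBall {ϖ : Kˣ} (hϖ : ‖(ϖ : K)‖ ≤ 1) :
    (piBall ϖ : OpenAddSubgroup K).toAddSubgroup ≤ (unitBall K).toAddSubgroup := fun _ hx =>
  mem_unitBall.mpr ((mem_piBall.mp hx).trans hϖ)

/-! ## §2 Measures of balls; the modulus -/

section measure

variable [MeasurableSpace K] [BorelSpace K] (μ : Measure K) [IsAddHaarMeasure μ]

omit [BorelSpace K] in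
/-- (Ported verbatim from the HodgeCMPerL package; no docstring in the source.) -/
theorem measure_closedBall_pos {r : ℝ} (hr : 0 < r) : 0 < μ (closedBall (0 : K) r) :=
  (isOpen_closedBall_zero hr).measure_pos μ ⟨0, mem_closedBall_self hr.le⟩

omit [IsUltrametricDist K] [BorelSpace K] in
/-- (Ported verbatim from the HodgeCMPerL package; no docstring in the source.) -/
theorem measure_closedBall_lt_top [ProperSpace K] (r : ℝ) : μ (closedBall (0 : K) r) < ∞ :=
  (isCompact_closedBall _ _).measure_lt_top

variable [ProperSpace K]

/-- **Haar scaling**: `μ (u • s) = |u|_K · μ s` for every additive Haar measure `μ` on `K`, every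
`u ∈ Kˣ` and every set `s` — Mathlib's `distribHaarChar_mul` (the modulus does not depend on `μ`). -/
theorem modulus_mul_measure (u : Kˣ) (s : Set K) :
    (distribHaarChar K u : ℝ≥0∞) * μ s = μ (u • s) := by
  haveI := regular_of_isAddHaarMeasure μ
  exact distribHaarChar_mul μ u s

/-- (Ported verbatim from the HodgeCMPerL package; no docstring in the source.) -/
theorem measure_units_smul (u : Kˣ) (s : Set K) : μ (u • s) = distribHaarChar K u * μ s :=
  (modulus_mul_measure μ u s).symm

/-- (Ported verbatim from the HodgeCMPerL package; no docstring in the source.) -/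
theorem measure_preimage_units_smul (u : Kˣ) (s : Set K) :
    μ ((fun x : K => u • x) ⁻¹' s) = distribHaarChar K u⁻¹ * μ s := by
  rw [preimage_smul, measure_units_smul]

omit [MeasurableSpace K] [BorelSpace K] in
/-- `|u|_K = 1` for a unit of norm one (`u • 𝒪 = 𝒪`). -/
theorem distribHaarChar_eq_one_of_norm_eq_one (u : Kˣ) (hu : ‖(u : K)‖ = 1) :
    distribHaarChar K u = 1 := by
  borelize K
  haveI := regular_of_isAddHaarMeasure (addHaar : Measure K)
  refine distribHaarChar_eq_of_measure_smul_eq_mul (μ := (addHaar : Measure K))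
    (s := closedBall (0 : K) 1) (measure_closedBall_pos _ one_pos).ne'
    (measure_closedBall_lt_top _ 1).ne ?_
  rw [units_smul_unitBall, hu, ENNReal.coe_one, one_mul]

omit [MeasurableSpace K] [BorelSpace K] in
/-- `|u|_K ≤ 1` when `‖u‖ ≤ 1` (`u • 𝒪 ⊆ 𝒪`). -/
theorem distribHaarChar_le_one_of_norm_le_one (u : Kˣ) (hu : ‖(u : K)‖ ≤ 1) :
    distribHaarChar K u ≤ 1 := by
  borelize K
  set μ₀ : Measure K := addHaar with hμ₀
  have h0 := (measure_closedBall_pos μ₀ (one_pos : (0 : ℝ) < 1)).ne'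
  have ht := (measure_closedBall_lt_top μ₀ (1 : ℝ)).ne
  have hle : μ₀ (u • closedBall (0 : K) 1) ≤ μ₀ (closedBall (0 : K) 1) := by
    rw [units_smul_unitBall]
    exact measure_mono (closedBall_subset_closedBall hu)
  rw [measure_units_smul] at hle
  have : (distribHaarChar K u : ℝ≥0∞) ≤ 1 := by
    calc (distribHaarChar K u : ℝ≥0∞)
        = distribHaarChar K u * μ₀ (closedBall (0 : K) 1) / μ₀ (closedBall (0 : K) 1) := by
          rw [ENNReal.mul_div_cancel_right h0 ht]
      _ ≤ μ₀ (closedBall (0 : K) 1) / μ₀ (closedBall (0 : K) 1) := by gcongr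
      _ = 1 := ENNReal.div_self h0 ht
  exact_mod_cast this

/-! ## §3 `|ϖ|_K = [𝒪 : ϖ𝒪]⁻¹` -/

/-- `q_ϖ := [𝒪 : ϖ𝒪]`, the index of the open subgroup `ϖ𝒪 ∩ 𝒪` in the compact group `𝒪`
(for a uniformizer `ϖ` this is the cardinality of the residue field). -/
def resIndex (ϖ : Kˣ) : ℕ :=
  (((piBall ϖ : OpenAddSubgroup K).toAddSubgroup).addSubgroupOf (unitBall K).toAddSubgroup).index

omit [MeasurableSpace K] [BorelSpace K] in
/-- (Ported verbatim from the HodgeCMPerL package; no docstring in the source.) -/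
theorem finiteIndex_piBall (ϖ : Kˣ) :
    (((piBall ϖ : OpenAddSubgroup K).toAddSubgroup).addSubgroupOf
      (unitBall K).toAddSubgroup).FiniteIndex := by
  haveI : CompactSpace ((unitBall K).toAddSubgroup) :=
    isCompact_iff_compactSpace.mp (isCompact_closedBall (0 : K) 1)
  haveI := AddSubgroup.quotient_finite_of_isOpen
    (((piBall ϖ : OpenAddSubgroup K).toAddSubgroup).addSubgroupOf (unitBall K).toAddSubgroup)
    (AddSubgroup.addSubgroupOf_isOpen _ _ (piBall ϖ).isOpen)
  exact AddSubgroup.finiteIndex_of_finite_quotient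

omit [MeasurableSpace K] [BorelSpace K] in
/-- (Ported verbatim from the HodgeCMPerL package; no docstring in the source.) -/
theorem resIndex_pos (ϖ : Kˣ) : 0 < resIndex ϖ := by
  haveI := finiteIndex_piBall ϖ
  exact Nat.pos_of_ne_zero AddSubgroup.FiniteIndex.index_ne_zero

omit [MeasurableSpace K] [BorelSpace K] in
/-- `2 ≤ [𝒪 : ϖ𝒪]` as soon as `‖ϖ‖ < 1` (`1 ∈ 𝒪 ∖ ϖ𝒪`). -/
theorem two_le_resIndex {ϖ : Kˣ} (hϖ : ‖(ϖ : K)‖ < 1) : 2 ≤ resIndex ϖ := by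
  haveI := finiteIndex_piBall ϖ
  have h0 : resIndex ϖ ≠ 0 := AddSubgroup.FiniteIndex.index_ne_zero
  have h1 : resIndex ϖ ≠ 1 := by
    intro h
    have htop := AddSubgroup.index_eq_one.mp h
    have hmem : (⟨(1 : K), mem_unitBall.mpr (le_of_eq norm_one)⟩ : (unitBall K).toAddSubgroup) ∈
        ((piBall ϖ : OpenAddSubgroup K).toAddSubgroup).addSubgroupOf (unitBall K).toAddSubgroup := by
      rw [htop]; exact AddSubgroup.mem_top _
    rw [AddSubgroup.mem_addSubgroupOf] at hmem
    have := mem_piBall.mp hmem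
    rw [norm_one] at this
    exact absurd this (not_le.mpr hϖ)
  unfold resIndex at *
  omega

omit [ProperSpace K] in
/-- The restriction of `μ` to the compact open subgroup `𝒪` is a left-invariant measure on `𝒪`. -/
theorem isAddLeftInvariant_comap :
    (μ.comap ((↑) : (unitBall K).toAddSubgroup → K)).IsAddLeftInvariant := by
  have hU : MeasurableSet (((unitBall K).toAddSubgroup : AddSubgroup K) : Set K) :=
    isClosed_closedBall.measurableSet
  have hemb : MeasurableEmbedding ((↑) : (unitBall K).toAddSubgroup → K) :=
    MeasurableEmbedding.subtype_coe hU
  refine ⟨fun g => ?_⟩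
  ext A hA
  rw [map_apply (measurable_const_add g) hA, hemb.comap_apply, hemb.comap_apply]
  have hset : ((↑) : (unitBall K).toAddSubgroup → K) '' ((fun x => g + x) ⁻¹' A) =
      (fun x : K => (g : K) + x) ⁻¹' (((↑) : (unitBall K).toAddSubgroup → K) '' A) := by
    ext x
    constructor
    · rintro ⟨a, ha, rfl⟩
      exact ⟨g + a, ha, by simp⟩
    · rintro ⟨a, ha, hax⟩
      simp only at hax
      have hx : x ∈ (unitBall K).toAddSubgroup := by
        have : x = (a : K) - (g : K) := by rw [hax]; abel
        rw [this]
        exact sub_mem a.2 g.2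
      refine ⟨⟨x, hx⟩, ?_, rfl⟩
      change g + ⟨x, hx⟩ ∈ A
      have : g + ⟨x, hx⟩ = a := by
        ext
        change (g : K) + x = a
        rw [hax]
      rwa [this]
  rw [hset, measure_preimage_add]

/-- **Coset counting**: `[𝒪 : ϖ𝒪] · μ(ϖ𝒪) = μ(𝒪)` (for `‖ϖ‖ ≤ 1`). -/
theorem resIndex_mul_measure {ϖ : Kˣ} (hϖ : ‖(ϖ : K)‖ ≤ 1) :
    (resIndex ϖ : ℝ≥0∞) * μ (closedBall (0 : K) ‖(ϖ : K)‖) = μ (closedBall (0 : K) 1) := by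
  haveI := finiteIndex_piBall ϖ
  haveI := isAddLeftInvariant_comap (K := K) μ
  have hU : MeasurableSet (((unitBall K).toAddSubgroup : AddSubgroup K) : Set K) :=
    isClosed_closedBall.measurableSet
  have hemb : MeasurableEmbedding ((↑) : (unitBall K).toAddSubgroup → K) :=
    MeasurableEmbedding.subtype_coe hU
  set H := ((piBall ϖ : OpenAddSubgroup K).toAddSubgroup).addSubgroupOf (unitBall K).toAddSubgroup
    with hH
  have hHm : MeasurableSet (H : Set (unitBall K).toAddSubgroup) := by
    rw [hH, AddSubgroup.coe_addSubgroupOf]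
    exact measurable_subtype_coe (isClosed_closedBall.measurableSet)
  have key := AddSubgroup.index_mul_measure H hHm (μ.comap ((↑) : (unitBall K).toAddSubgroup → K))
  rw [hemb.comap_apply, hemb.comap_apply, image_univ, Subtype.range_coe_subtype] at key
  have h1 : ((↑) : (unitBall K).toAddSubgroup → K) '' (H : Set (unitBall K).toAddSubgroup) =
      closedBall (0 : K) ‖(ϖ : K)‖ := by
    rw [hH, AddSubgroup.coe_addSubgroupOf, AddSubgroup.coe_subtype]
    ext x
    constructor
    · rintro ⟨a, ha, rfl⟩
      exact ha
    · intro hx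
      exact ⟨⟨x, (piBall_le_unitBall hϖ) hx⟩, hx, rfl⟩
  have h2 : {x : K | x ∈ (unitBall K).toAddSubgroup} = closedBall (0 : K) 1 := rfl
  rw [h1, h2] at key
  exact key

omit [MeasurableSpace K] [BorelSpace K] in
/-- **`|ϖ|_K = 1/q_ϖ`**: the modulus of `ϖ` (`‖ϖ‖ ≤ 1`) is the inverse of the index `[𝒪 : ϖ𝒪]`
(a statement about `K` alone: no measure, no σ-algebra). -/
theorem distribHaarChar_uniformizer {ϖ : Kˣ} (hϖ : ‖(ϖ : K)‖ ≤ 1) :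
    distribHaarChar K ϖ = ((resIndex ϖ : ℝ≥0))⁻¹ := by
  borelize K
  set μ : Measure K := addHaar with hμ
  haveI := regular_of_isAddHaarMeasure μ
  have h0 := (measure_closedBall_pos μ (one_pos : (0 : ℝ) < 1)).ne'
  have ht := (measure_closedBall_lt_top μ (1 : ℝ)).ne
  have hq : (resIndex ϖ : ℝ≥0∞) ≠ 0 := by exact_mod_cast (resIndex_pos ϖ).ne'
  have hq' : (resIndex ϖ : ℝ≥0∞) ≠ ∞ := ENNReal.natCast_ne_top _
  refine distribHaarChar_eq_of_measure_smul_eq_mul (μ := μ) (s := closedBall (0 : K) 1) h0 ht ?_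
  rw [units_smul_unitBall]
  have key := resIndex_mul_measure μ hϖ
  rw [ENNReal.coe_inv (by exact_mod_cast (resIndex_pos ϖ).ne'), ENNReal.coe_natCast,
    ← key, ← mul_assoc, ENNReal.inv_mul_cancel hq hq', one_mul]

omit [MeasurableSpace K] [BorelSpace K] in
/-- the same in `ℝ`: `|ϖ|_K = (q_ϖ : ℝ)⁻¹` -/
theorem distribHaarChar_uniformizer_real {ϖ : Kˣ} (hϖ : ‖(ϖ : K)‖ ≤ 1) :
    ((distribHaarChar K ϖ : ℝ≥0) : ℝ) = ((resIndex ϖ : ℝ))⁻¹ := by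
  rw [distribHaarChar_uniformizer hϖ, NNReal.coe_inv, NNReal.coe_natCast]

end measure

/-! ## §4 Boxes in `K^d` -/

section boxes

variable [MeasurableSpace K] [BorelSpace K] [ProperSpace K] (μ : Measure K) [IsAddHaarMeasure μ]
  (d : ℕ)

/-- the box `s^d ⊆ K^d` -/
abbrev box (s : Set K) : Set (Fin d → K) := univ.pi fun _ => s

omit [BorelSpace K] in
/-- (Ported verbatim from the HodgeCMPerL package; no docstring in the source.) -/
theorem measure_box (s : Set K) : Measure.pi (fun _ : Fin d => μ) (box d s) = μ s ^ d := by
  rw [box, Measure.pi_pi, Finset.prod_const, Finset.card_univ, Fintype.card_fin]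

omit [IsUltrametricDist K] [MeasurableSpace K] [BorelSpace K] [ProperSpace K] in
/-- (Ported verbatim from the HodgeCMPerL package; no docstring in the source.) -/
theorem smul_box (u : Kˣ) (s : Set K) : u • box d s = box d (u • s) :=
  smul_set_univ_pi u fun _ => s

omit [IsUltrametricDist K] [MeasurableSpace K] [BorelSpace K] [ProperSpace K] in
/-- (Ported verbatim from the HodgeCMPerL package; no docstring in the source.) -/
theorem preimage_smul_box (u : Kˣ) (s : Set K) :
    (fun x : Fin d → K => u • x) ⁻¹' box d s = box d ((fun x : K => u • x) ⁻¹' s) := by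
  rw [preimage_smul, smul_box, preimage_smul]

omit [NontriviallyNormedField K] [IsUltrametricDist K] [MeasurableSpace K] [BorelSpace K] [ProperSpace K] in
/-- (Ported verbatim from the HodgeCMPerL package; no docstring in the source.) -/
theorem box_inter (s t : Set K) : box d s ∩ box d t = box d (s ∩ t) := by
  rw [box, box, ← pi_inter_distrib]

omit [MeasurableSpace K] [BorelSpace K] in
/-- **`|u|_{K^d} = |u|_K ^ d`**: the modulus of the diagonal action of `Kˣ` on `K^d`. -/
theorem distribHaarChar_pi (u : Kˣ) : distribHaarChar (Fin d → K) u = distribHaarChar K u ^ d := by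
  borelize K
  set μ : Measure K := addHaar with hμ
  haveI := regular_of_isAddHaarMeasure (Measure.pi fun _ : Fin d => μ)
  have h0 : Measure.pi (fun _ : Fin d => μ) (box d (closedBall (0 : K) 1)) ≠ 0 := by
    rw [measure_box]
    exact pow_ne_zero _ (measure_closedBall_pos μ one_pos).ne'
  have ht : Measure.pi (fun _ : Fin d => μ) (box d (closedBall (0 : K) 1)) ≠ ∞ := by
    rw [measure_box]
    exact ENNReal.pow_ne_top (measure_closedBall_lt_top μ 1).ne
  refine distribHaarChar_eq_of_measure_smul_eq_mul (μ := Measure.pi fun _ : Fin d => μ) h0 ht ?_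
  rw [smul_box, measure_box, measure_box, measure_units_smul, mul_pow, ENNReal.coe_pow]

/-- (Ported verbatim from the HodgeCMPerL package; no docstring in the source.) -/
theorem measure_units_smul_pi (u : Kˣ) (s : Set (Fin d → K)) :
    Measure.pi (fun _ : Fin d => μ) (u • s) =
      (distribHaarChar K u : ℝ≥0∞) ^ d * Measure.pi (fun _ : Fin d => μ) s := by
  haveI := regular_of_isAddHaarMeasure (Measure.pi fun _ : Fin d => μ)
  rw [← distribHaarChar_mul (Measure.pi fun _ : Fin d => μ) u s, distribHaarChar_pi d,
    ENNReal.coe_pow]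

/-- the push-forward of the product Haar measure under `x ↦ u • x` is `|u|_K^{-d}` times itself -/
theorem map_units_smul_pi (u : Kˣ) :
    (Measure.pi fun _ : Fin d => μ).map (fun x : Fin d → K => u • x) =
      ((distribHaarChar K u⁻¹ : ℝ≥0∞) ^ d) • Measure.pi fun _ : Fin d => μ := by
  ext s hs
  rw [map_apply (measurable_const_smul u) hs, Measure.smul_apply, smul_eq_mul, preimage_smul,
    measure_units_smul_pi]

end boxes

end HodgeCM.PerL34.LocalModulus
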